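import Literature.AnabelianGeometry.SemiGraphs.PSCSeparatingCoveringsTwoComponentAffineEdges
import HarnessLib

/-!
# [CombGC] Prop. 1.2, proof p. 9: rows F-2829 / F-2830 at the genuine two-component affine data of non-sturdy type

Mochizuki, *A combinatorial version of the Grothendieck conjecture*, Tohoku Math. J. **59** (2007)
[CombGC], PROOF of Proposition 1.2, author's manuscript p. 9 (separating coverings)
[cite: MochizukiCombGC2007, Prop 1.2 proof p.9]; abc-iut FACT-LIST rows F-2829
`PSCDatum.SeparatingCoverings` (= verticial ∧ edge-like ∧ `Π^unr`-verticial separating coverings, sub-DAG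
row P12-L01 of abc-iut-w4-d081's `PSCSeparatingCoverings.lean`) and F-2830 `SeparatingCoveringsHolds Ω`
(the same over an origin `Ω`); universal closures refuted, instance forms so far only at ONE-VERTEX data.

PROOF-ONLY file (abc-iut-f-166 gen 3), the assembly of `PSCSeparatingCoveringsTwoComponentAffine.lean`
(verticial conjunct, p457653) and `…Edges.lean` (edge-like conjunct): at the two-component affine data of
abc-iut-f-164 the verticial and edge-like conjuncts hold by the free-factor theorems; the third conjunct
`UnrVerticialSeparatingCoverings` is an implication `G.IsSturdy → …` ("under the further assumption
that `G` is sturdy", print p. 9), VACUOUS at data with a component of genus `≤ 1`.  Hence: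

* `unrVerticialSeparatingCoverings_of_not_isSturdy` — the `Π^unr` conjunct at non-sturdy data;
* `separatingCoverings_of_twoComponentAffine_of_not_isSturdy` — **row F-2829 at every two-component
  affine datum with a component of genus `≤ 1`** (verticial and edge conjuncts GENUINE, `Π^unr` conjunct
  vacuous — honest label);
* `exists_twoComponentAffine_separatingCoverings` — inhabited: a datum with two genus-`1` components, one
  node and four cusps (`i = 2`, `n = 1`, `r = 4`) satisfying F-2829;
* `exists_twoComponentAffineOrigin_separatingCoveringsHolds` — **row F-2830 at the (inhabited) origin of
  non-sturdy two-component affine data**, the first multi-vertex origin for F-2830.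

The sturdy case of the `Π^unr` conjunct (both genera `≥ 2`, where `Π^unr_G` is the free pro-`Σ` product of
two CLOSED surface groups) needs the free-product form of the fibred twist and is NOT claimed.  A shape
instance is consistency evidence for the typed schema, not the printed statement for all pointed stable
curves (cell FOUNDATIONS rows 13–14).  0 definitions; nothing here takes a side on [IUTchIII] Cor. 3.12.
-/

noncomputable section

namespace Literature.AnabelianGeometry.SemiGraphs

namespace PSCDatum

open scoped Pointwise
open Literature.GroupTheory.CombinatorialGroupTheory
open Literature.GroupTheory.CombinatorialGroupTheory.PuncturedSurfaceGroup (cuspInertia)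
open SemiGraphOfAnabelioids (IsProSigmaCompletion)

/-! ### The `Π^unr` conjunct at non-sturdy data -/

section NotSturdy

variable {P : Type*} [Group P] [TopologicalSpace P] [IsTopologicalGroup P]

/-- The `Π^unr`-verticial separating-coverings clause is an implication from sturdiness ("under the
further assumption that `G` is sturdy", [CombGC] p. 9); at non-sturdy data it holds vacuously.
[cite: MochizukiCombGC2007, Prop 1.2 proof p.9] -/
theorem unrVerticialSeparatingCoverings_of_not_isSturdy (G : PSCDatum P) (h : ¬ G.IsSturdy) :
    G.UnrVerticialSeparatingCoverings :=
  fun hst => absurd hst h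

omit [IsTopologicalGroup P] in
/-- A vertex of genus `≤ 1` makes the datum non-sturdy. [cite: MochizukiCombGC2007, Rmk 1.1.5 p.8] -/
theorem not_isSturdy_of_genus_le_one (G : PSCDatum P) (v : G.graph.V) (hv : G.genus v ≤ 1) :
    ¬ G.IsSturdy :=
  fun hst => absurd (hst v) (by omega)

end NotSturdy

/-! ### Row F-2829 at non-sturdy two-component affine data -/

section TwoComponentAffine

variable {P : Type} [Group P] [TopologicalSpace P] [IsTopologicalGroup P]
variable [CompactSpace P] [TotallyDisconnectedSpace P] {Sigma : Set ℕ} {g r : ℕ}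

/-- **Row F-2829 `SeparatingCoverings` at the genuine two-component affine data with a component of
genus `≤ 1`.**  Verticial conjunct: `verticialSeparatingCoverings_of_twoComponentAffine` (fibred twist +
projection); edge-like conjunct: `edgeLikeSeparatingCoverings_of_twoComponentAffine` (rank-one free
factors); `Π^unr` conjunct: vacuous (`¬ G.IsSturdy`). [cite: MochizukiCombGC2007, Prop 1.2 proof p.9] -/
theorem separatingCoverings_of_twoComponentAffine_of_not_isSturdy (hne : Sigma.Nonempty)
    (hprime : ∀ p ∈ Sigma, p.Prime) (ι : PuncturedSurfaceGroup g r →* P)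
    (hι : IsProSigmaCompletion Sigma ι) (G : PSCDatum P) {g₀ s : ℕ} (hs : 2 ≤ s) (hsr : s + 2 ≤ r)
    (e : G.graph.C ≃ Fin r)
    (hC : ∀ c, G.cuspGp c = ((cuspInertia (g := g) (e c)).map ι).topologicalClosure)
    (v₀ v₁ : G.graph.V) (hV : ∀ w, w = v₀ ∨ w = v₁) (n₀ : G.graph.N) (hN : ∀ n, n = n₀)
    (ε : PuncturedSurfaceGroup g r)
    (hε : ε = ((List.finRange r).map fun j : Fin r =>
          if s ≤ (j : ℕ) then PuncturedSurfaceGroup.c (g := g) j else 1).prod *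
        ((List.finRange g).map fun i : Fin g => if (i : ℕ) < g₀ then
          PuncturedSurfaceGroup.a (r := r) i * PuncturedSurfaceGroup.b i *
            (PuncturedSurfaceGroup.a i)⁻¹ * (PuncturedSurfaceGroup.b i)⁻¹ else 1).prod)
    (hV₀ : G.vertGp v₀ = ((Subgroup.closure {x : PuncturedSurfaceGroup g r |
        (∃ i : Fin g, (i : ℕ) < g₀ ∧ (x = PuncturedSurfaceGroup.a i ∨ x = PuncturedSurfaceGroup.b i)) ∨
        ∃ j : Fin r, s ≤ (j : ℕ) ∧ x = PuncturedSurfaceGroup.c j}).map ι).topologicalClosure)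
    (hV₁ : G.vertGp v₁ = ((Subgroup.closure {x : PuncturedSurfaceGroup g r |
        (∃ i : Fin g, g₀ ≤ (i : ℕ) ∧ (x = PuncturedSurfaceGroup.a i ∨ x = PuncturedSurfaceGroup.b i)) ∨
        (∃ j : Fin r, (j : ℕ) < s ∧ x = PuncturedSurfaceGroup.c j) ∨ x = ε}).map ι).topologicalClosure)
    (hE : G.nodeGp n₀ = ((Subgroup.zpowers ε).map ι).topologicalClosure) (hns : ¬ G.IsSturdy) :
    G.SeparatingCoverings :=
  ⟨G.verticialSeparatingCoverings_of_twoComponentAffine hne hprime ι hι hs hsr v₀ v₁ hV ε hε hV₀ hV₁,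
    G.edgeLikeSeparatingCoverings_of_twoComponentAffine hne hprime ι hι hs hsr e hC n₀ hN ε hε hE,
    G.unrVerticialSeparatingCoverings_of_not_isSturdy hns⟩

/-- **Non-vacuity of row F-2829 at genuine multi-vertex data**: for every nonempty set of primes `Σ` an
inhabited profinite pro-`Σ` datum with TWO genus-`1` vertices, ONE node and four cusps (abc-iut-f-164's
`exists_twoComponentAffineDatum 2 4 1 2`) satisfies `SeparatingCoverings`.
[cite: MochizukiCombGC2007, Prop 1.2 proof p.9] -/
theorem exists_twoComponentAffine_separatingCoverings (Sigma : Set ℕ) (hne : Sigma.Nonempty)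
    (hprime : ∀ p ∈ Sigma, p.Prime) :
    ∃ (Q : ProfiniteGrp.{0}) (G : PSCDatum Q), G.Sigma = Sigma ∧ G.graph.i = 2 ∧ G.graph.n = 1 ∧
      G.graph.r = 4 ∧ (∀ v, G.genus v = 1) ∧ G.SeparatingCoverings := by
  obtain ⟨Q, ι, G, e, v₀, v₁, n₀, ε, hι, hSg, hi, hn, hr, hC, hV, hN, hε, hV₀, hV₁, hE, hg₀, hg₁, -⟩ :=
    exists_twoComponentAffineDatum Sigma hne hprime 2 4 1 2
  have hgen : ∀ v, G.genus v = 1 := fun v => by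
    rcases hV v with rfl | rfl
    · exact hg₀
    · exact hg₁
  exact ⟨Q, G, hSg, hi, hn, hr, hgen,
    G.separatingCoverings_of_twoComponentAffine_of_not_isSturdy hne hprime ι hι (g₀ := 1) (s := 2)
      le_rfl le_rfl e hC v₀ v₁ hV n₀ hN ε hε hV₀ hV₁ hE
      (G.not_isSturdy_of_genus_le_one v₀ (by rw [hgen v₀]))⟩

end TwoComponentAffine

/-! ### Row F-2830 at the origin of non-sturdy two-component affine data -/

/-- **Row F-2830 `SeparatingCoveringsHolds Ω` at the INHABITED origin `Ω_tca¬st` of the data of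
two-component affine shape with a component of genus `≤ 1`** (over profinite pro-`Σ` completions of
`Γ_{g,r}` in `Type`; abc-iut-f-164's shape with the extra clause `¬ G.IsSturdy`): every datum of the
origin has separating coverings (verticial and edge conjuncts genuine, `Π^unr` conjunct vacuous), and
the origin is inhabited by a datum with two genus-`1` vertices, one node and four cusps.  The first
multi-vertex origin at which F-2830 is settled in the kernel. [cite: MochizukiCombGC2007, Prop 1.2 proof p.9] -/
theorem exists_twoComponentAffineOrigin_separatingCoveringsHolds (Sigma : Set ℕ) (hne : Sigma.Nonempty)
    (hprime : ∀ p ∈ Sigma, p.Prime) :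
    ∃ Ω : PSCOrigin.{0},
      (∃ (Q : ProfiniteGrp.{0}) (G : PSCDatum Q), Ω.IsOfPSCType G ∧ G.Sigma = Sigma ∧ G.graph.i = 2 ∧
        G.graph.n = 1 ∧ G.graph.r = 4) ∧
      SeparatingCoveringsHolds Ω := by
  classical
  let Ω : PSCOrigin.{0} :=
    ⟨fun {Q} _ _ G => ∃ (_ : IsTopologicalGroup Q), CompactSpace Q ∧ TotallyDisconnectedSpace Q ∧
      ¬ G.IsSturdy ∧
      ∃ (S : Set ℕ) (g r g₀ s : ℕ) (ι : PuncturedSurfaceGroup g r →* Q) (e : G.graph.C ≃ Fin r)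
        (v₀ v₁ : G.graph.V) (n₀ : G.graph.N) (ε : PuncturedSurfaceGroup g r),
        S.Nonempty ∧ (∀ p ∈ S, p.Prime) ∧ IsProSigmaCompletion S ι ∧ 2 ≤ s ∧ s + 2 ≤ r ∧
        (∀ c, G.cuspGp c = ((cuspInertia (g := g) (e c)).map ι).topologicalClosure) ∧
        (∀ w, w = v₀ ∨ w = v₁) ∧ (∀ n, n = n₀) ∧
        ε = ((List.finRange r).map fun j : Fin r =>
          if s ≤ (j : ℕ) then PuncturedSurfaceGroup.c (g := g) j else 1).prod *
        ((List.finRange g).map fun i : Fin g => if (i : ℕ) < g₀ then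
          PuncturedSurfaceGroup.a (r := r) i * PuncturedSurfaceGroup.b i *
            (PuncturedSurfaceGroup.a i)⁻¹ * (PuncturedSurfaceGroup.b i)⁻¹ else 1).prod ∧
        G.vertGp v₀ = ((Subgroup.closure {x : PuncturedSurfaceGroup g r |
          (∃ i : Fin g, (i : ℕ) < g₀ ∧ (x = PuncturedSurfaceGroup.a i ∨ x = PuncturedSurfaceGroup.b i)) ∨
          ∃ j : Fin r, s ≤ (j : ℕ) ∧ x = PuncturedSurfaceGroup.c j}).map ι).topologicalClosure ∧
        G.vertGp v₁ = ((Subgroup.closure {x : PuncturedSurfaceGroup g r |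
          (∃ i : Fin g, g₀ ≤ (i : ℕ) ∧ (x = PuncturedSurfaceGroup.a i ∨ x = PuncturedSurfaceGroup.b i)) ∨
          (∃ j : Fin r, (j : ℕ) < s ∧ x = PuncturedSurfaceGroup.c j) ∨ x = ε}).map ι).topologicalClosure ∧
        G.nodeGp n₀ = ((Subgroup.zpowers ε).map ι).topologicalClosure⟩
  refine ⟨Ω, ?_, ?_⟩
  · obtain ⟨Q, ι, G, e, v₀, v₁, n₀, ε, hι, hSg, hi, hn, hr, hC, hV, hN, hε, hV₀, hV₁, hE, hg₀, -, -⟩ :=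
      exists_twoComponentAffineDatum Sigma hne hprime 2 4 1 2
    refine ⟨Q, G, ?_, hSg, hi, hn, hr⟩
    exact ⟨inferInstance, inferInstance, inferInstance,
      G.not_isSturdy_of_genus_le_one v₀ (by rw [hg₀]),
      Sigma, 2, 4, 1, 2, ι, e, v₀, v₁, n₀, ε, hne, hprime, hι, le_rfl, le_rfl, hC, hV, hN, hε, hV₀, hV₁, hE⟩
  · intro Q _ _ _ G hG
    obtain ⟨_, hcpt, htd, hns, S, g, r, g₀, s, ι, e, v₀, v₁, n₀, ε, hSne, hSp, hι, hs, hsr, hC, hV, hN, hε,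
      hV₀, hV₁, hE⟩ := hG
    haveI := hcpt
    haveI := htd
    exact G.separatingCoverings_of_twoComponentAffine_of_not_isSturdy hSne hSp ι hι hs hsr e hC v₀ v₁ hV
      n₀ hN ε hε hV₀ hV₁ hE hns

end PSCDatum

end Literature.AnabelianGeometry.SemiGraphs

end
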